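import Summits.ResolutionOfSingularities.ResolutionOfSingularities.Theorems.HilbertSamuelEliminationCampaignW54PersistentEnclosure
import Literature.AlgebraicGeometry.Hironaka2017.S06BaseHike.R040eThm614Amb
import Literature.AlgebraicGeometry.Hironaka2017.S04CharAlgebra.R005bEdgeData
import HarnessLib

/-!
# [OURS · L1 W5.4, variant S2] The W5.4-S2 campaign statements INSTANTIATED at the core-edge-focused class
# (`CampaignW54.AdmCoreFocus`, `CampaignW54.AdmR07`); replaces the ROLE of the standing antecedent «`Ě` is the
# core-edge focusing of `E`» (§6.2 p.30 L4–L15, Eq. (45)) of Th. 10.4 [b] p.60 L23–L26; NOT a statement of the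
# manuscript

Cell `res-hironaka` (run/shared/lean/pub/res-hironaka/), LADDER-RESOLUTION rung L (rescue), RESCUE-SEED slot W5.4,
variant S2 (delayed / persistent regular enclosure). Fourth W5.4 file of OURS typer o5 (statement-only lane), after
`…CampaignW54SingInRidge.lean` (p468011), `…CampaignW54DelayedEnclosure.lean` (S2, p470679) and
`…CampaignW54PersistentEnclosure.lean` (rung 1, p478737). Those files state the four global campaign statements
PARAMETRICALLY in an admissibility predicate `Adm : ∀ ⦃Z⦄, IdealExponent Z → Prop` on the ideal exponent the
procedure runs on (`CampaignW54EventualRegularEnclosureOf p Adm`, `CampaignW54DelayedRegularEnclosureOf p N Adm`,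
`CampaignW54PersistentEnclosureStepOf p Adm`, `CampaignW54MaximalContactOf p Adm`). The G6 enclosure lead named the
instantiation the GAP-LEDGER row R07 (Th. 10.4 [b]) consumes (HOME/INBOX.md 2026-08-27T01:30:05Z, res-adj-6, to
res-L1-type-o5): **`Adm_R07 := fun Z E => E.IsStandard ∧ IsCoreFocus E`** — «the class on which R07 claims Th 10.4 [b]
is … row 010 `IsCoreFocus`, §6.2 (43)/(44), the standing antecedent of every row-069d set-up instance; `E.IsStandard`
you already carry, so effectively `Adm := IsCoreFocus`»; with two provisos typed here VERBATIM: (a) the §9/§10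
local-notion bundle (`LN`, `IsDiffOp`, rows 068/022) is NOT a predicate of `E` and «MUST NOT be existentially
quantified inside `Adm`» (with a permissive `LN`, LL-chains exist at every closed point and [b] is false — the lead's
instance file v4, sha16 d258d5a03355f5d6); (b) chain / enclosure existence enters the S2 statements only through their
own hypothesis `CampaignW54.RegularEnclosureAt E ξ` (= R07's OUTPUT at `ξ`), so no chain-level input is added.

## What «`IsCoreFocus E`» is in the tree, and how this file closes it (nothing is re-declared)

Row 010 typed §6.2 p.30 twice: `S06BaseHike.IsCoreFocus pAlg inv Ê Ě` over two hypothesis bundles (file `b`,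
p457487) and, once the carriers landed, `S06BaseHike.IsCoreFocus_inst Ê Ě ed` (file `d`): ℘ := row 003's geometric
`S04CharAlgebra.pAlg`, `Inv_ξ(Ê) := S04CharAlgebra.inv (ed ξ)` read off a FAMILY `ed : EdgeDataOn p n Ê` of edge data
of `℘(Ê)` at the closed points of `Sing(Ê)` (Eq. (34) p.24 L21–L22; the campaign convention of rows 009/010/012: every
printed `Inv_ξ(Ê)` is read «for every family of edge data with the Def. 4.9 provenance»). Row 040 file `e`
(`R040eThm614Amb`) packaged «`Ě` is a core focusing of `Ê` for SOME certified family» as the two-place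
predicate `S06BaseHike.IsCoreFocusOfSome IsEdgeData p n Ê Ě := ∃ ed, IsEdgeDataOn IsEdgeData Ê ed ∧ IsCoreFocus_inst Ê
Ě ed`, parametric in the Def. 4.9 provenance predicate `IsEdgeData` (row 007's shape; row 005b's `IsEdgeData` = Def.
4.9 as printed, row 005d's `IsEdgeData_alg` = the Rem. 4.10 algebra reading — ADJUDICATION-PROTOCOL §4 M4, one verdict
per reading). In rows 013/040/069d/070f and Cor. 14.7 the core-focus predicate is a free PARAMETER (`IsCoreFocusOf :
IdealExponent A.Z → IdealExponent A.Z → Prop`, resp. the one-place `IsCoreFocus : IdealExponent A.Z → Prop` of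
`S10LLChainMod.Thm10_4_b_setup`). Accordingly this file offers THREE layers, all by application, no new carrier:

* `CampaignW54.IsCoreEdgeFocusOf IsCoreFocusOf` — the one-place class «`Ě` is the core-edge focusing (Eq. (45)) of SOME
  standard `E` on the same scheme» for a two-place core-focus predicate polymorphic in the scheme (the parameter of
  rows 013/040/Cor. 14.7, made scheme-polymorphic because `Adm` is): `fun Z Ě => ∃ E, E.IsStandard ∧ IsCoreFocusOf
  (baseHike E) Ě`. This IS the lead's `fun Z E => … ∧ IsCoreFocus E` with «core-focused» spelled «core focus of the
  maximum base-hike of some standard `E`» (p.30 L13–L14 «the core-edge focusing of Ê (also that of E)»).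
* `CampaignW54.isCoreFocusOfSomeDim IsEdgeData p` — row 040e's `IsCoreFocusOfSome IsEdgeData p n`, made
  scheme-polymorphic by `∃ n`. WHY `∃ n` IS NOT JUNK: `Adm` sees only `(Z, Ě)`, not «`n = dim Z`» (Eq. (34): «with
  n = dim Z»); but the Def. 4.9 provenance of an edge datum at a closed point `ξ` (`S04CharAlgebra.IsEdgeData`, and
  equally `IsEdgeData_alg`) begins «∃ z : Fin n → 𝒪_ξ, IsRSP 𝒪_ξ z» — a regular system of parameters of LENGTH `n` —
  so at any closed point of the smooth irreducible `A.Z` the witness `n` is forced to be `dim 𝒪_{Z,ξ} = dim Z`; the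
  only exponents `Ê` for which a wrong `n` can be certified are those with `Sing(Ê)_cl = ∅` (empty family), and for
  them Eq. (43) gives `Sing(Ě)_cl = invmaxStratum ∅ _ = ∅`, where every campaign statement below (all quantify over
  CLOSED `ξ ∈ Sing(Ě)`) is vacuous anyway. So `∃ n` and «`n = dim Z`» give the same four statements.
* `CampaignW54.AdmCoreFocus IsEdgeData p := IsCoreEdgeFocusOf (isCoreFocusOfSomeDim IsEdgeData p)` (parametric in
  the Def. 4.9 reading only) and the CLOSED `CampaignW54.AdmR07 p := AdmCoreFocus edgeDataDef49 p` at Def. 4.9 AS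
  PRINTED (row 005b); the Rem. 4.10 reading is `AdmCoreFocus (fun ⦃_⦄ ⦃_ _⦄ _ _ D => S04CharAlgebra.IsEdgeData_alg D) p`
  by application (not declared separately).

Then the four campaign statements at these classes (`…CoreFocusOf p IsEdgeData` parametric in the reading,
`…R07 p` closed), the rung-1 statement ALSO in the DRESSED header shape of row 040e / row 069d
(`CampaignW54PersistentEnclosureStepAmb IsEdgeData p`: binders `A, n, E, hE, ed, hed, Ě, hĚ` explicit, exactly
`S06BaseHike.Thm6_14_1_amb`'s header) with the `↔` to the `Adm`-form proved (pure logic: uncurrying the existentials),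
and pure-logic anchors (ladder implications, antitonicity instances, unfolding lemmas). 23 declarations (14
definitions, of which 9 global `Prop` statements + the 5 class/plumbing definitions; 9 pure-logic theorems).

## OURS-layer protocol (verbatim, applies to every declaration below)
* STANDING RULE: built on rung L; every statement here is OURS — «[OURS · L1 W5.4 S2] replaces the role of <printed
  item>; NOT a statement of the manuscript». Nothing is attributed to the author. Hironaka's statements are CANDIDATES
  [claim: Hironaka2017, status: under-review], consumed only as hypotheses (here: only typed CARRIERS of rows
  001/003/005/007/009/010/040e appear, as parameters of definitions; no candidate claim is a premise of anything).
* FACT-LIST §A/§B: no row is consumed by this file.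
* NOT a claim about resolution of singularities; AI typing, weaker than expert review.
* VACUITY self-check (T-rule): (i) `AdmR07 p Ě` is inhabited at `(A, Ě)` iff some standard `E` on `A.Z` has a
  core-edge focusing `Ě` with a certified edge-data family — the content of row 010d's existence sentence
  `S06BaseHike.U30_2_inst` (p.30 L4–L8, «EXISTENCE NOT SHOWN IN PRINT») — so the instantiated statements are exactly
  as contentful as R07's own class and NOT automatically true; kernel core-focus certificates of record use the
  bundle form of file `b`, `IsCoreFocus S04CharAlgebra.pAlg inv …` for every `inv` whose `Inv_max`-stratum is all
  of `Sing_cl` (res-type-010, `Proofs/S06BaseHike/U30L4dSpecimenB.lean` p484139, `specimenB_isCoreFocus`;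
  §11-frame certificate announced HOME/STATUS 2026-08-27T01:46:11Z), none yet with certified edge data — declared,
  not hidden. (ii) Not automatically false: the conclusions are the S2 predicates of the sibling files, open on the
  cell's ledger (K5.4 ADDENDUM j259915: level-1 delayed enclosure holds at both Weierstrass–Quadratflächen origins;
  `CampaignW54MaximalContactOf` is PREDICTED FALSE by barrier block (P) for every `Adm` admitting the Hauser/CJS
  surfaces — whether a core-edge-focused `Ě` of that shape exists is itself open, so the prediction is recorded, not
  transferred). (iii) Degenerate instances declared: at `Ě` with `Sing(Ě)_cl = ∅` every statement is vacuous (see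
  «WHY `∃ n` IS NOT JUNK»); `E.IsStandard` for the running `Ě` is kept as the sibling files' hypothesis although R07's
  rows do not print it (a WEAKENING only: `…Of p Adm` with it is implied by the version without it).
* KILL-TEST RECORD: K5.4 DEAD on lever (W_G) (res-L1-k54 20:33:11Z, p472102); S2 alive, wake-gated on R07 (director
  20:39:03Z (1), 21:27:42Z (2)); this file changes no verdict and wakes nothing.

## References (context / orientation only; no statement below is cited as a fact from them)
* Locators: «p.N Lk» = printed line k of HOME/lit/layout/p00NN.txt (layout files re-read for this file, 2026-08-27).
* H. Hironaka, ms. 2017-03-23, §6.2 p.30 L3–L17 (Eq. (43)–(45), «core-edge focusing»); Def. 4.9 p.20 L29–L33 /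
  Rem. 4.10 p.21 L3–L6; Eq. (34) p.24 L21–L22; §2 p.6 L23–L24; §10.1 Th. 10.4 p.60 L23–L26 — roles under
  adjudication (GAP-LEDGER R07, group 6; row 010), not cited as fact. [Hironaka2017]
* Cell files: HOME/INBOX.md 2026-08-27T01:30:05Z (res-adj-6 ENCLOSURE-INPUTS, + STATUS ERRATA 01:35:31Z); the three
  sibling Theorems files (typer o5); `S06BaseHike/R010dECheckInst.lean`, `R040eThm614Amb.lean`,
  `S10LLChainMod/R069dSetupReadings.lean` (parameter shapes). (OURS)
-/

noncomputable section

set_option linter.dupNamespace false -- mandated namespace of this single-conjunct summit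

open _root_.CategoryTheory _root_.AlgebraicGeometry _root_.TopologicalSpace
open Literature.AlgebraicGeometry.Resolution
open Literature.AlgebraicGeometry.Hironaka2017.S02Preliminaries
open Literature.AlgebraicGeometry.Hironaka2017.S04CharAlgebra
open Literature.AlgebraicGeometry.Hironaka2017.S06BaseHike

namespace Summit.ResolutionOfSingularities.ResolutionOfSingularities.Theorems

universe u

namespace CampaignW54

/-! ## The core-edge-focused admissibility classes -/

/-- **[OURS · L1 W5.4 S2] `IsCoreEdgeFocusOf IsCoreFocusOf` — the admissibility class «`Ě` is the core-edge focusing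
of SOME standard ideal exponent on the same scheme»; replaces the role of the standing antecedent of Th. 10.4 p.60
L23–L26 («`Ě`» = the core-edge focusing of §6.2 p.30 L13–L14, Eq. (45) «E ⇢ Ê ⇢ Ě»); NOT a statement of the
manuscript.** For a two-place core-focus predicate `IsCoreFocusOf Ê Ě` polymorphic in the scheme (the free parameter
of rows 013/040/Cor. 14.7, there per ambient scheme): `Ě ↦ ∃ E, E.IsStandard ∧ IsCoreFocusOf (baseHike E) Ě`
(row 001 `IsStandard`: `J ≠ 0 ∧ 0 < b`, §2 p.6 L23–L24 / §6.1 p.29 L15–L17; row 009 `baseHike` = `Ê`). The shape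
`fun Z E => … ∧ IsCoreFocus E` named by the G6 lead (HOME/INBOX 2026-08-27T01:30:05Z), item (a) of the module
docstring respected: no local-notion bundle is quantified here. [folklore] -/
def IsCoreEdgeFocusOf (IsCoreFocusOf : ∀ ⦃Z : Scheme.{u}⦄, IdealExponent Z → IdealExponent Z → Prop) :
    ∀ ⦃Z : Scheme.{u}⦄, IdealExponent Z → Prop :=
  fun Z Echeck => ∃ E : IdealExponent Z, E.IsStandard ∧ IsCoreFocusOf (baseHike E) Echeck

/-- **[OURS · L1 W5.4 S2] `isCoreFocusOfSomeDim IsEdgeData p` — row 040e's «`Ě` is a core focusing of `Ê` for SOME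
certified family of edge data» (`S06BaseHike.IsCoreFocusOfSome IsEdgeData p n Ê Ě`, over row 010d's
`IsCoreFocus_inst`: ℘ := `S04CharAlgebra.pAlg`, `Inv_ξ(Ê) := inv (ed ξ)`, Eq. (43) + maximality, p.30 L4–L8) made
polymorphic in the scheme by `∃ n`; replaces the role of «Inv_ξ(E) = (n, n − r, q_1, …, q_r) with n = dim Z» (Eq. (34)
p.24) inside the class; NOT a statement of the manuscript.** `∃ n` is forced to `dim Z` by the length-`n` regular
system of parameters in the Def. 4.9 provenance whenever `Sing(Ê)_cl ≠ ∅`, and is idle otherwise (module docstring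
«WHY `∃ n` IS NOT JUNK»). Parametric in the Def. 4.9 reading `IsEdgeData` (row 007's parameter shape). [folklore] -/
def isCoreFocusOfSomeDim
    (IsEdgeData : ∀ ⦃X : Scheme.{u}⦄ ⦃p n : ℕ⦄ (E : IdealExponent X) (ξ : X), EdgeDatumAt p n E ξ → Prop)
    (p : ℕ) [Fact p.Prime] : ∀ ⦃Z : Scheme.{u}⦄, IdealExponent Z → IdealExponent Z → Prop :=
  fun _ Ehat Echeck => ∃ n : ℕ, IsCoreFocusOfSome IsEdgeData p n Ehat Echeck

/-- **[OURS · L1 W5.4 S2] `edgeDataDef49` — the Def. 4.9 provenance parameter instantiated AT THE PRINTED READING**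
(row 005b `S04CharAlgebra.IsEdgeData` = Def. 4.9 p.20 L29–L33 «homogeneous lifts of a minimum system of homogeneous
generators of the IDEAL `℘̄(E)(ξ)`»), in row 007's parameter shape (`EdgeDatumAt p n E ξ` is row 005a's `EdgeDatum`
over `𝒪_ξ`, so application typechecks by unfolding); replaces the role of nothing — plumbing; NOT a statement of the
manuscript. The Rem. 4.10 algebra reading is `fun ⦃_⦄ ⦃_ _⦄ _ _ D => S04CharAlgebra.IsEdgeData_alg D` (row 005d).
[folklore] -/
def edgeDataDef49 : ∀ ⦃X : Scheme.{u}⦄ ⦃p n : ℕ⦄ (E : IdealExponent X) (ξ : X), EdgeDatumAt p n E ξ → Prop :=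
  fun ⦃_⦄ ⦃_ _⦄ _ _ D => Literature.AlgebraicGeometry.Hironaka2017.S04CharAlgebra.IsEdgeData D

/-- **[OURS · L1 W5.4 S2] `AdmCoreFocus IsEdgeData p` — the core-edge-focused admissibility class over the tree's
CLOSED carriers, parametric only in the Def. 4.9 reading: `Ě ↦ ∃ E standard, ∃ n, ∃ ed` (a family of edge data of
`℘(Ê)`, `Ê = baseHike E`, on `Sing(Ê)_cl` with the `IsEdgeData` provenance) with `IsCoreFocus_inst Ê Ě ed`;
replaces the role of the standing antecedent «`Ě` core-edge focused» of Th. 10.4 p.60 L23–L26 (§6.2 p.30 L4–L15);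
NOT a statement of the manuscript.** = `IsCoreEdgeFocusOf (isCoreFocusOfSomeDim IsEdgeData p)`. [folklore] -/
def AdmCoreFocus
    (IsEdgeData : ∀ ⦃X : Scheme.{u}⦄ ⦃p n : ℕ⦄ (E : IdealExponent X) (ξ : X), EdgeDatumAt p n E ξ → Prop)
    (p : ℕ) [Fact p.Prime] : ∀ ⦃Z : Scheme.{u}⦄, IdealExponent Z → Prop :=
  IsCoreEdgeFocusOf (isCoreFocusOfSomeDim IsEdgeData p)

/-- **[OURS · L1 W5.4 S2] `AdmR07 p` — the CLOSED admissibility class the GAP-LEDGER row R07 (Th. 10.4 [b]) consumes,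
per the G6 lead's instantiation «`Adm_R07 := fun Z E => E.IsStandard ∧ IsCoreFocus E`» (HOME/INBOX
2026-08-27T01:30:05Z): `AdmCoreFocus edgeDataDef49 p` — «`Ě` is the core-edge focusing (Eq. (45), §6.2 p.30) of some
standard `E`, for some family of edge data with the Def. 4.9 provenance AS PRINTED»; replaces the role of that
standing antecedent of Th. 10.4 p.60 L23–L26; NOT a statement of the manuscript.** Inhabited exactly where row 010d's
existence sentence `U30_2_inst` provides an `Ě` (EXISTENCE NOT SHOWN IN PRINT; module docstring, VACUITY (i)).
[folklore] -/
def AdmR07 (p : ℕ) [Fact p.Prime] : ∀ ⦃Z : Scheme.{u}⦄, IdealExponent Z → Prop :=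
  AdmCoreFocus edgeDataDef49 p

/-- Unfolding lemma: membership of `Ě` in `AdmCoreFocus IsEdgeData p` is literally «∃ standard `E`, ∃ `n`, ∃ certified
family `ed` of edge data of `baseHike E` with `IsCoreFocus_inst (baseHike E) Ě ed`» (pure logic, `Iff.rfl` up to
unfolding). [folklore] -/
theorem admCoreFocus_iff
    {IsEdgeData : ∀ ⦃X : Scheme.{u}⦄ ⦃p n : ℕ⦄ (E : IdealExponent X) (ξ : X), EdgeDatumAt p n E ξ → Prop}
    {p : ℕ} [Fact p.Prime] {Z : Scheme.{u}} (Echeck : IdealExponent Z) :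
    AdmCoreFocus IsEdgeData p Echeck ↔
      ∃ E : IdealExponent Z, E.IsStandard ∧ ∃ (n : ℕ) (ed : EdgeDataOn p n (baseHike E)),
        IsEdgeDataOn IsEdgeData (baseHike E) ed ∧ IsCoreFocus_inst (baseHike E) Echeck ed :=
  Iff.rfl

/-- `AdmCoreFocus IsEdgeData p` is an instance of the parametric class `IsCoreEdgeFocusOf` (at the two-place predicate
`isCoreFocusOfSomeDim IsEdgeData p`); definitional (pure logic). [folklore] -/
theorem admCoreFocus_eq
    (IsEdgeData : ∀ ⦃X : Scheme.{u}⦄ ⦃p n : ℕ⦄ (E : IdealExponent X) (ξ : X), EdgeDatumAt p n E ξ → Prop)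
    (p : ℕ) [Fact p.Prime] :
    AdmCoreFocus IsEdgeData p = IsCoreEdgeFocusOf (isCoreFocusOfSomeDim IsEdgeData p) :=
  rfl

/-- Monotonicity of the parametric class in its core-focus predicate: if `IsCoreFocusOf Ê Ě → IsCoreFocusOf' Ê Ě`
everywhere then `IsCoreEdgeFocusOf IsCoreFocusOf Ě → IsCoreEdgeFocusOf IsCoreFocusOf' Ě` (pure logic; feeds the
sibling files' `_anti` theorems when a consumer coarsens the core-focus reading). [folklore] -/
theorem isCoreEdgeFocusOf_mono
    {IsCoreFocusOf IsCoreFocusOf' : ∀ ⦃Z : Scheme.{u}⦄, IdealExponent Z → IdealExponent Z → Prop}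
    (hle : ∀ ⦃Z : Scheme.{u}⦄ (Ehat Echeck : IdealExponent Z), IsCoreFocusOf Ehat Echeck → IsCoreFocusOf' Ehat Echeck)
    ⦃Z : Scheme.{u}⦄ (Echeck : IdealExponent Z) (h : IsCoreEdgeFocusOf IsCoreFocusOf Echeck) :
    IsCoreEdgeFocusOf IsCoreFocusOf' Echeck := by
  obtain ⟨E, hE, hc⟩ := h
  exact ⟨E, hE, hle _ _ hc⟩

end CampaignW54

/-! ## The four W5.4-S2 campaign statements at the core-edge-focused class -/

/-- **[OURS · L1 W5.4, variant S2 — rung 1] `CampaignW54PersistentEnclosureStepCoreFocusOf p IsEdgeData` — ONE-STEP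
PERSISTENCE WITH RE-CHOICE (`CampaignW54PersistentEnclosureStepOf`, p478737) INSTANTIATED at
`Adm := CampaignW54.AdmCoreFocus IsEdgeData p`; replaces the ROLE of Th. 10.4 [b] p.60 L23–L26 for one step of the
procedure at every closed singular point of a CORE-EDGE-FOCUSED `Ě` (§6.2 p.30) where a regular enclosure exists; NOT
a statement of the manuscript.** Parametric in the Def. 4.9 reading only; the closed form is
`CampaignW54PersistentEnclosureStepR07`. [folklore] -/
def CampaignW54PersistentEnclosureStepCoreFocusOf (p : ℕ) [Fact p.Prime]
    (IsEdgeData : ∀ ⦃X : Scheme.{u}⦄ ⦃p n : ℕ⦄ (E : IdealExponent X) (ξ : X), EdgeDatumAt p n E ξ → Prop) :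
    Prop :=
  CampaignW54PersistentEnclosureStepOf.{u} p (CampaignW54.AdmCoreFocus IsEdgeData p)

/-- **[OURS · L1 W5.4, variant S2 — rung 1] `CampaignW54PersistentEnclosureStepR07 p` — the R07 CONSUMER FORM of the
rung-1 statement: `CampaignW54PersistentEnclosureStepOf p (CampaignW54.AdmR07 p)`; for every perfect field `K` of
characteristic `p`, ambient datum `A`, standard `Ě` on `A.Z` which is the core-edge focusing of some standard `E`
(certified edge data, Def. 4.9 as printed), and every CLOSED `ξ ∈ Sing(Ě)` with `CampaignW54.RegularEnclosureAt Ě ξ`: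
`CampaignW54.PersistentEnclosureAt (CampaignW54.permissibleCentres K) A.hom Ě ξ`; replaces the ROLE of Th. 10.4 [b]
p.60 L23–L26 for one step of the procedure on R07's own class; NOT a statement of the manuscript.** OPEN on the cell's
ledger; the statement res-adj-6's R07 consumer row cites by name. [folklore] -/
def CampaignW54PersistentEnclosureStepR07 (p : ℕ) [Fact p.Prime] : Prop :=
  CampaignW54PersistentEnclosureStepOf.{u} p (CampaignW54.AdmR07 p)

/-- **[OURS · L1 W5.4, variant S2 — top rung] `CampaignW54MaximalContactCoreFocusOf p IsEdgeData` — PERMANENT CONTACT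
(`CampaignW54MaximalContactOf`, p478737) INSTANTIATED at `Adm := CampaignW54.AdmCoreFocus IsEdgeData p`; replaces the
ROLE of Th. 10.4 [b] p.60 L23–L26 along the whole procedure on core-edge-focused `Ě`; NOT a statement of the
manuscript.** PREDICTED FALSE by barrier block (P) IF a core-edge-focused `Ě` of the Hauser §14 Ex. 1 / CJS Thm 15.3
shape exists (module docstring, VACUITY (ii)); typed as the named target of that prediction. [folklore] -/
def CampaignW54MaximalContactCoreFocusOf (p : ℕ) [Fact p.Prime]
    (IsEdgeData : ∀ ⦃X : Scheme.{u}⦄ ⦃p n : ℕ⦄ (E : IdealExponent X) (ξ : X), EdgeDatumAt p n E ξ → Prop) :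
    Prop :=
  CampaignW54MaximalContactOf.{u} p (CampaignW54.AdmCoreFocus IsEdgeData p)

/-- **[OURS · L1 W5.4, variant S2 — top rung] `CampaignW54MaximalContactR07 p` — permanent contact on R07's class:
`CampaignW54MaximalContactOf p (CampaignW54.AdmR07 p)`; replaces the ROLE of Th. 10.4 [b] p.60 L23–L26 along the whole
procedure on core-edge-focused `Ě` (Def. 4.9 as printed); NOT a statement of the manuscript.** [folklore] -/
def CampaignW54MaximalContactR07 (p : ℕ) [Fact p.Prime] : Prop :=
  CampaignW54MaximalContactOf.{u} p (CampaignW54.AdmR07 p)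

/-- **[OURS · L1 W5.4, variant S2] `CampaignW54EventualRegularEnclosureCoreFocusOf p IsEdgeData` — EVENTUAL REGULAR
ENCLOSURE after finitely many point blow-ups (`CampaignW54EventualRegularEnclosureOf`, p470679) INSTANTIATED at
`Adm := CampaignW54.AdmCoreFocus IsEdgeData p`; replaces the ROLE of Th. 10.4 [b] p.60 L23–L26 («V ∩ Sing(Ě) ⊆ Y»)
at the closed singular points of core-edge-focused `Ě`, with delay; NOT a statement of the manuscript.** (The S2 file's
default instantiation was `CampaignW54.IsMaxOrder`; whether a core-edge-focused `Ě` is a maximal-order exponent is not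
claimed here — the two instantiations are recorded side by side.) [folklore] -/
def CampaignW54EventualRegularEnclosureCoreFocusOf (p : ℕ) [Fact p.Prime]
    (IsEdgeData : ∀ ⦃X : Scheme.{u}⦄ ⦃p n : ℕ⦄ (E : IdealExponent X) (ξ : X), EdgeDatumAt p n E ξ → Prop) :
    Prop :=
  CampaignW54EventualRegularEnclosureOf.{u} p (CampaignW54.AdmCoreFocus IsEdgeData p)

/-- **[OURS · L1 W5.4, variant S2] `CampaignW54EventualRegularEnclosureR07 p` — eventual regular enclosure on R07's
class: `CampaignW54EventualRegularEnclosureOf p (CampaignW54.AdmR07 p)`; replaces the ROLE of Th. 10.4 [b] p.60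
L23–L26 at the closed singular points of core-edge-focused `Ě` (Def. 4.9 as printed), with delay; NOT a statement of
the manuscript.** [folklore] -/
def CampaignW54EventualRegularEnclosureR07 (p : ℕ) [Fact p.Prime] : Prop :=
  CampaignW54EventualRegularEnclosureOf.{u} p (CampaignW54.AdmR07 p)

/-- **[OURS · L1 W5.4, variant S2] `CampaignW54DelayedRegularEnclosureCoreFocusOf p N IsEdgeData` — REGULAR ENCLOSURE
WITHIN `N` point blow-ups (`CampaignW54DelayedRegularEnclosureOf p N`, p470679) INSTANTIATED at
`Adm := CampaignW54.AdmCoreFocus IsEdgeData p`; replaces the ROLE of Th. 10.4 [b] p.60 L23–L26 at the closed singular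
points of core-edge-focused `Ě`, with delay `≤ N`; NOT a statement of the manuscript.** [folklore] -/
def CampaignW54DelayedRegularEnclosureCoreFocusOf (p : ℕ) [Fact p.Prime] (N : ℕ)
    (IsEdgeData : ∀ ⦃X : Scheme.{u}⦄ ⦃p n : ℕ⦄ (E : IdealExponent X) (ξ : X), EdgeDatumAt p n E ξ → Prop) :
    Prop :=
  CampaignW54DelayedRegularEnclosureOf.{u} p N (CampaignW54.AdmCoreFocus IsEdgeData p)

/-- **[OURS · L1 W5.4, variant S2] `CampaignW54DelayedRegularEnclosureR07 p N` — regular enclosure within `N` point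
blow-ups on R07's class: `CampaignW54DelayedRegularEnclosureOf p N (CampaignW54.AdmR07 p)`; replaces the ROLE of
Th. 10.4 [b] p.60 L23–L26 at the closed singular points of core-edge-focused `Ě` (Def. 4.9 as printed), with delay
`≤ N`; NOT a statement of the manuscript.** [folklore] -/
def CampaignW54DelayedRegularEnclosureR07 (p : ℕ) [Fact p.Prime] (N : ℕ) : Prop :=
  CampaignW54DelayedRegularEnclosureOf.{u} p N (CampaignW54.AdmR07 p)

/-! ## The rung-1 statement in the DRESSED header shape of rows 040e / 069d, and its equivalence with the `Adm`-form -/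

/-- **[OURS · L1 W5.4, variant S2 — rung 1, dressed] `CampaignW54PersistentEnclosureStepAmb IsEdgeData p` — the rung-1
statement with the core-focus binders EXPLICIT, in exactly the header shape of `S06BaseHike.Thm6_14_1_amb` (row 040e)
/ the `IsCoreFocus Ě →` antecedent of `S10LLChainMod.Thm10_4_b_setup` (row 069d): for every perfect `K` of
characteristic `p`, ambient datum `A`, `n : ℕ`, standard `E` on `A.Z`, family `ed` of edge data of `Ê = baseHike E` on
`Sing(Ê)_cl` with the `IsEdgeData` provenance, and `Ě` with `IsCoreFocus_inst Ê Ě ed` and `Ě` standard: at every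
CLOSED `ξ ∈ Sing(Ě)` with `CampaignW54.RegularEnclosureAt Ě ξ`, `CampaignW54.PersistentEnclosureAt
(CampaignW54.permissibleCentres K) A.hom Ě ξ`; replaces the ROLE of Th. 10.4 [b] p.60 L23–L26 for one step of the
procedure; NOT a statement of the manuscript.** Equivalent to `CampaignW54PersistentEnclosureStepCoreFocusOf p
IsEdgeData` (`campaignW54PersistentEnclosureStepAmb_iff`). [folklore] -/
def CampaignW54PersistentEnclosureStepAmb
    (IsEdgeData : ∀ ⦃X : Scheme.{u}⦄ ⦃p n : ℕ⦄ (E : IdealExponent X) (ξ : X), EdgeDatumAt p n E ξ → Prop)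
    (p : ℕ) [Fact p.Prime] : Prop :=
  ∀ (K : Type u) [Field K] [CharP K p] [PerfectField K]
    (A : AmbientDatum p K) (n : ℕ) (E : IdealExponent A.Z) (_ : E.IsStandard) (ed : EdgeDataOn p n (baseHike E))
    (_ : IsEdgeDataOn IsEdgeData (baseHike E) ed) (Echeck : IdealExponent A.Z)
    (_ : IsCoreFocus_inst (baseHike E) Echeck ed), Echeck.IsStandard →
    ∀ (ξ : A.Z), ξ ∈ Echeck.sing ∩ Literature.AlgebraicGeometry.Hironaka2017.S02Preliminaries.closedPoints A.Z →
      CampaignW54.RegularEnclosureAt Echeck ξ →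
        CampaignW54.PersistentEnclosureAt (CampaignW54.permissibleCentres K) A.hom Echeck ξ

/-- The dressed form and the `Adm`-form of the rung-1 statement are EQUIVALENT (pure logic: the binders
`n, E, hE, ed, hed, hĚ` of the dressed form are the uncurried existentials of `CampaignW54.AdmCoreFocus`). [folklore] -/
theorem campaignW54PersistentEnclosureStepAmb_iff
    (IsEdgeData : ∀ ⦃X : Scheme.{u}⦄ ⦃p n : ℕ⦄ (E : IdealExponent X) (ξ : X), EdgeDatumAt p n E ξ → Prop)
    (p : ℕ) [Fact p.Prime] :
    CampaignW54PersistentEnclosureStepAmb IsEdgeData p ↔ CampaignW54PersistentEnclosureStepCoreFocusOf p IsEdgeData := by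
  constructor
  · intro h K _ _ _ A Echeck hEc hAdm ξ hξ hreg
    obtain ⟨E, hE, n, ed, hed, hc⟩ := hAdm
    exact h K A n E hE ed hed Echeck hc hEc ξ hξ hreg
  · intro h K _ _ _ A n E hE ed hed Echeck hc hEc ξ hξ hreg
    exact h K A Echeck hEc ⟨E, hE, n, ed, hed, hc⟩ ξ hξ hreg

/-! ## Pure-logic anchors (ladder and antitonicity instances) -/

/-- Ladder on R07's class: permanent contact implies one-step persistence with re-choice
(`CampaignW54MaximalContactR07 p → CampaignW54PersistentEnclosureStepR07 p`); instance of
`campaignW54PersistentEnclosureStepOf_of_maximalContact`. [folklore] -/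
theorem campaignW54PersistentEnclosureStepR07_of_maximalContactR07 {p : ℕ} [Fact p.Prime]
    (h : CampaignW54MaximalContactR07.{u} p) : CampaignW54PersistentEnclosureStepR07.{u} p :=
  campaignW54PersistentEnclosureStepOf_of_maximalContact h

/-- Ladder on R07's class: enclosure within `N` point blow-ups implies eventual enclosure
(`CampaignW54DelayedRegularEnclosureR07 p N → CampaignW54EventualRegularEnclosureR07 p`); instance of
`campaignW54EventualRegularEnclosureOf_of_delayed`. [folklore] -/
theorem campaignW54EventualRegularEnclosureR07_of_delayedR07 {p : ℕ} [Fact p.Prime] {N : ℕ}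
    (h : CampaignW54DelayedRegularEnclosureR07.{u} p N) : CampaignW54EventualRegularEnclosureR07.{u} p :=
  campaignW54EventualRegularEnclosureOf_of_delayed h

/-- The R07 forms are the `…CoreFocusOf` forms at the printed Def. 4.9 reading (definitional; pure logic). [folklore] -/
theorem campaignW54PersistentEnclosureStepR07_iff (p : ℕ) [Fact p.Prime] :
    CampaignW54PersistentEnclosureStepR07.{u} p ↔
      CampaignW54PersistentEnclosureStepCoreFocusOf.{u} p CampaignW54.edgeDataDef49 :=
  Iff.rfl

/-- Antitonicity instance: the rung-1 statement for ANY admissibility class containing the core-edge-focused one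
implies the core-edge-focused statement — e.g. a consumer who proves `CampaignW54PersistentEnclosureStepOf p Adm` for
`Adm ⊇ AdmCoreFocus IsEdgeData p` has proved `CampaignW54PersistentEnclosureStepCoreFocusOf p IsEdgeData`
(instance of `campaignW54PersistentEnclosureStepOf_anti`; pure logic). [folklore] -/
theorem campaignW54PersistentEnclosureStepCoreFocusOf_of_stepOf {p : ℕ} [Fact p.Prime]
    {IsEdgeData : ∀ ⦃X : Scheme.{u}⦄ ⦃p n : ℕ⦄ (E : IdealExponent X) (ξ : X), EdgeDatumAt p n E ξ → Prop}
    {Adm : ∀ ⦃Z : Scheme.{u}⦄, IdealExponent Z → Prop}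
    (hle : ∀ ⦃Z : Scheme.{u}⦄ (E : IdealExponent Z), CampaignW54.AdmCoreFocus IsEdgeData p E → Adm E)
    (h : CampaignW54PersistentEnclosureStepOf.{u} p Adm) :
    CampaignW54PersistentEnclosureStepCoreFocusOf.{u} p IsEdgeData :=
  campaignW54PersistentEnclosureStepOf_anti hle h

/-- Antitonicity instance for the eventual-enclosure statement (instance of
`campaignW54EventualRegularEnclosureOf_anti`; pure logic). [folklore] -/
theorem campaignW54EventualRegularEnclosureCoreFocusOf_of_eventualOf {p : ℕ} [Fact p.Prime]
    {IsEdgeData : ∀ ⦃X : Scheme.{u}⦄ ⦃p n : ℕ⦄ (E : IdealExponent X) (ξ : X), EdgeDatumAt p n E ξ → Prop}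
    {Adm : ∀ ⦃Z : Scheme.{u}⦄, IdealExponent Z → Prop}
    (hle : ∀ ⦃Z : Scheme.{u}⦄ (E : IdealExponent Z), CampaignW54.AdmCoreFocus IsEdgeData p E → Adm E)
    (h : CampaignW54EventualRegularEnclosureOf.{u} p Adm) :
    CampaignW54EventualRegularEnclosureCoreFocusOf.{u} p IsEdgeData :=
  campaignW54EventualRegularEnclosureOf_anti hle h

end Summit.ResolutionOfSingularities.ResolutionOfSingularities.Theorems

end
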